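import Literature.AlgebraicGeometry.ModuliOfAbelianVarieties.SiegelPrincipalLevelNormal
import Literature.AlgebraicGeometry.ModuliOfAbelianVarieties.SiegelPrincipalLevelFree
import Literature.AlgebraicGeometry.ModuliOfAbelianVarieties.SiegelModuliRelation
import HarnessLib

/-!
# The adelic ↔ integral dictionary at principal level: `GSp_δ(ℚ) ∩ K_δ(N) = Γ_δ(N)`, and the fibres of
# `Z ↦ [J(Z), r·K_δ(N)]` on `𝔥_g` ([Milne ISV] Lemma 5.13 for `GSp_δ`, injectivity half; [Deligne 1971] 4.16)

Topic `AlgebraicGeometry/ModuliOfAbelianVarieties`; namespace `Literature.AlgebraicGeometry.ModuliOfAbelianVarieties`.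
THEOREMS ONLY (no definition, no named fact, no instance, no `sorry`).  Cell hodgecm-mathlib (D-0151), #60 road
(`SiegelS1`) leaf R60-11 (A-p05 TABLE v1.2): banked generic capital toward the «piece index» C1 (a) of the Siegel
complex record system (★ (σ3) `SiegelComplexRecordSystem`: `Q K`, `rep K q`, `incl_unif`).  HC_CM is proved only modulo
the 7 printed citations until rung 0 closes; this file proves no cell binder.

## The mathematics (printed)

[Milne2005ShimuraVarieties] Lemma 5.13 p. 57: «`Sh_K(G,X)(ℂ) = G(ℚ)∖X × G(𝔸_f)/K ≅ ⨆_{g ∈ 𝒞} Γ_g∖X⁺`, where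
`Γ_g = gKg⁻¹ ∩ G(ℚ)₊`», with footnote 40: «If `[x, g] = [x′, g]`, then `x′ = qx` and `g = qgk` … we find that
`q ∈ Γ_g`, and so `[x] = [x′]`»; §6 p. 70 (the Siegel modular variety) and [Deligne1971TravauxShimura] Exemple 4.16
p. 150: `K(N) = {g ∈ CSp(V̂_ℤ) | g ≡ 1 mod N}`, `Γ = K(N) ∩ G(ℚ)`; [MumfordFogartyKirwan1994] App. 7A: «`Γ_n = {A ∈
Sp(2g, ℤ) | A ≡ I_{2g} (mod n)}`» and `𝒜*_{g,1,n} × Spec ℂ ≅ 𝔥_g/Γ_n`; [GenestierNgo2020] Prop. 1.3.2.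

In the tree's coordinates (a symplectic basis of type `δ`, form `E_δ = (0 Δ; -Δ 0)`): the adelic principal level
★ `principalLevelSubgroup δ N = K_δ(N) = {γ ∈ GSp_δ(𝔸_{ℚ,f}) | γ ≡ 1, γ⁻¹ ≡ 1 (mod N·𝓞̂)}` (★ (σ3)) and the INTEGER
group ★ `siegelLevelGroup δ N = Γ_δ(N) = {M ∈ Sp_δ(ℤ) | M ≡ 1 (mod N)}` of ★ `SiegelModuliDatum` (whose field
`unif_eq_unif_iff` is stated over `Γ_δ(N)`) are related by

* §1 `intCast_mem_levelIdeal_iff` (`ℤ ∩ N·𝓞̂ = Nℤ`; cf. ★ `NumberTheory/Adeles/RatFiniteIdeleCongruenceClasses`), `isCongOne_map_intCast_iff` (an INTEGER matrix is `≡ 1 (mod N·𝓞̂)`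
  in `𝔸_f` iff its reduction mod `N` is `1`);
* §2 (integral ⇒ adelic) `map_mem_principalLevelSubgroup_iff_mem_siegelLevelGroup`: for `M ∈ Sp_δ(ℤ)`, the rational
  similitude `M_ℚ ∈ GSp_δ(ℚ)` (★ `map_mem_gspRational_of_mem_symplecticLatticeGroup`) lies in `K_δ(N)` iff `M ∈ Γ_δ(N)`;
* §3 (adelic ⇒ integral) **`exists_siegelLevelGroup_map_eq_of_mem_principalLevelSubgroup`**: for `N ≥ 3`, `0 < g`
  and `δ` a polarisation type, every `γ ∈ GSp_δ(ℚ)` with `γ ∈ K_δ(N)` (adelically) IS `M_ℚ` for a unique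
  `M ∈ Γ_δ(N)` — entries in `ℚ ∩ ℤ̂ = ℤ` (★ `SiegelPrincipalLevelFree`), `det γ = ±1` (★), hence the multiplier `ν`
  satisfies `ν^{2g} = 1`, `ν = ±1`, and `ν = -1` is excluded by reducing `ᵗM E_{δ/δ₀} M = ν E_{δ/δ₀}` modulo `N`
  (the `(0, g)` entry of `E_{δ/δ₀}` is `1`, so `ν ≡ 1 (mod N)`, impossible for `ν = -1`, `N ≥ 3`);
  packaged as `mem_principalLevelSubgroup_iff_exists_siegelLevelGroup` («`GSp_δ(ℚ) ∩ K_δ(N) = Γ_δ(N)`»);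
* §4 the STABILISER of a representative `r ∈ K_δ(1) = GSp_δ(ℤ̂)`: `r⁻¹ γ r ∈ K_δ(N) ↔ γ ∈ K_δ(N)` (★ normality), the
  fibre criterion `SiegelShimuraSet.mk_eq_mk_iff_of_right` (`[J, rK] = [J′, rK] ↔ ∃ γ ∈ GSp_δ(ℚ), γJ′γ⁻¹ = J ∧
  r⁻¹γr ∈ K`), and the EQUIVARIANT READING on `𝔥_g`: for `M ∈ Sp_δ(ℤ)` the real point of `M_ℚ` is Lange's `A_N`,
  `N = gDHom M ∈ Sp_{2g}(ℝ)` (★ `SiegelModuliRelation.gDHom`, ★ `toSpForm`), so `M_ℚ · J(Z) = J(gDHom M • Z)`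
  (★ Lemma 7.1.7 `jOfSiegel_smul`); whence the HEAD
  **`SiegelShimuraSet.mk_jOfSiegel_eq_mk_jOfSiegel_iff`**: for `Z, Z′ ∈ 𝔥_g`, `r ∈ K_δ(1)`, `N ≥ 3`:
  `[J(Z), rK_δ(N)] = [J(Z′), rK_δ(N)] ↔ ∃ M ∈ Γ_δ(N), Z = gDHom M • Z′` — EXACTLY the relation of
  ★ `SiegelModuliDatum.unif_eq_unif_iff_exists_smul`, so that for every Siegel fine moduli datum `D` of level `N`
  the fibres of `Z ↦ [J(Z), rK_δ(N)]` are the fibres of `D.unif` (`mk_jOfSiegel_eq_mk_jOfSiegel_iff_unif_eq_unif`):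
  the piece map `D.S(ℂ) = Γ_δ(N)∖𝔥_g → Sh_{K_δ(N)}(ℂ)` is well defined and injective
  (`SiegelModuliDatum.exists_pieceMap`).  The SURJECTIVITY half of Lemma 5.13 (strong approximation for `Sp_δ`, the
  idèle classes `ℚ^×_{>0}∖𝔸_f^×/(ẑ^× ∩ (1+Nẑ))`, representatives of `GSp(ℚ)₊∖GSp(𝔸_f)/K`) is NOT here (R60-8/8b/12/13).

## References
* [Milne2005ShimuraVarieties] J. S. Milne, *Introduction to Shimura varieties* (2005), §5 Lemma 5.13 p. 57 (with
  footnotes 40–41), §6 p. 70.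
* [Deligne1971TravauxShimura] P. Deligne, *Travaux de Shimura*, Sém. Bourbaki 389 (1971), 0.4 p. 126, Exemple 4.16 p. 150.
* [MumfordFogartyKirwan1994] D. Mumford, J. Fogarty, F. Kirwan, *Geometric Invariant Theory*, Appendix to Ch. 7 §A.
* [GenestierNgo2020] A. Genestier, B. C. Ngô, *Lectures on Shimura varieties*, §1.3 and Prop. 1.3.2.
* [Lange2023AbelianVarietiesComplex] H. Lange, *Abelian Varieties over the Complex Numbers* (2023), §3.1.4 (3.8),
  §7.1.2 Lemma 7.1.7.
-/

set_option autoImplicit false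

noncomputable section

open Matrix NumberField IsDedekindDomain

namespace Literature.AlgebraicGeometry.ModuliOfAbelianVarieties

open SiegelModuli
open Literature.NumberTheory.Automorphic (siegelUpperHalfSpace)
open Literature.NumberTheory.ModularForms.SiegelUpperHalfSpace (coe_smul)

variable {g : ℕ}

/-! ### §1. Integers in `𝔸_{ℚ,f}`: `ℤ ∩ N·𝓞̂ = Nℤ`, and congruence of integer matrices -/

section Integers

/-- An integer is an integral finite adèle (private twin of ★ `Literature.NumberTheory.Adeles.intCast_mem_integralAdeles`,
whose module is not imported here). [folklore] -/
private theorem intCast_mem_integralAdeles (z : ℤ) : (z : finAdeleQ) ∈ FiniteAdeleRing.integralAdeles (𝓞 ℚ) ℚ :=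
  intCast_mem _ z

/-- **`ℤ ∩ N·𝓞̂ = Nℤ`** (`N ≠ 0`): an integer lies in `N·𝓞̂ ⊂ 𝔸_{ℚ,f}` iff `N` divides it (`ℚ ∩ ℤ̂ = ℤ` applied to
`z/N`). [cite: Deligne1971TravauxShimura, 0.4 p. 126 and Exemple 4.16 p. 150] -/
theorem intCast_mem_levelIdeal_iff {N : ℕ} (hN : N ≠ 0) {z : ℤ} :
    (z : finAdeleQ) ∈ levelIdeal N ↔ (N : ℤ) ∣ z := by
  constructor
  · intro h
    obtain ⟨y, hy, hyeq⟩ := mem_levelIdeal_iff.1 h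
    have hNq : (N : ℚ) ≠ 0 := Nat.cast_ne_zero.2 hN
    -- `y = z / N` read in `𝔸_{ℚ,f}`
    have hunit : IsUnit (N : finAdeleQ) := by
      rw [← map_natCast (algebraMap ℚ finAdeleQ)]
      exact (IsUnit.mk0 _ hNq).map _
    have hyq : algebraMap ℚ finAdeleQ ((z : ℚ) / N) = y := by
      apply hunit.mul_left_cancel
      rw [hyeq, ← map_natCast (algebraMap ℚ finAdeleQ) N, ← map_mul, mul_div_cancel₀ _ hNq, map_intCast]
    obtain ⟨w, hw⟩ := exists_int_cast_eq_of_algebraMap_mem_integralAdeles (x := (z : ℚ) / N) (by rw [hyq]; exact hy)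
    refine ⟨w, ?_⟩
    have : (z : ℚ) = N * w := by rw [hw, mul_div_cancel₀ _ hNq]
    exact_mod_cast this
  · rintro ⟨k, rfl⟩
    refine mem_levelIdeal_iff.2 ⟨k, intCast_mem_integralAdeles k, ?_⟩
    rw [Int.cast_mul, Int.cast_natCast]

variable {n : Type} [Fintype n] [DecidableEq n]

omit [Fintype n] in
/-- **An INTEGER matrix is `≡ 1 (mod N·𝓞̂)` in `M_n(𝔸_{ℚ,f})` iff its reduction modulo `N` is the identity** (`N ≠ 0`).
[cite: Deligne1971TravauxShimura, Exemple 4.16 p. 150] [cite: MumfordFogartyKirwan1994, Appendix to Ch. 7 §A] -/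
theorem isCongOne_map_intCast_iff {N : ℕ} (hN : N ≠ 0) (A : Matrix n n ℤ) :
    IsCongOne N (A.map (Int.castRingHom finAdeleQ)) ↔ A.map (Int.castRingHom (ZMod N)) = 1 := by
  have hsub : ∀ i j, (A.map (Int.castRingHom finAdeleQ) - 1) i j = (((A - 1) i j : ℤ) : finAdeleQ) := by
    intro i j
    rw [← Matrix.map_one (Int.castRingHom finAdeleQ) (map_zero _) (map_one _), ← Matrix.map_sub _ (map_sub _),
      Matrix.map_apply, eq_intCast]
  have hsub' : ∀ i j, (A.map (Int.castRingHom (ZMod N)) - 1) i j = (((A - 1) i j : ℤ) : ZMod N) := by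
    intro i j
    rw [← Matrix.map_one (Int.castRingHom (ZMod N)) (map_zero _) (map_one _), ← Matrix.map_sub _ (map_sub _),
      Matrix.map_apply, eq_intCast]
  rw [← sub_eq_zero (a := A.map (Int.castRingHom (ZMod N)))]
  constructor
  · intro h
    ext i j
    rw [hsub', Matrix.zero_apply, ZMod.intCast_zmod_eq_zero_iff_dvd]
    have := h i j
    rw [hsub i j] at this
    exact (intCast_mem_levelIdeal_iff hN).1 this
  · intro h i j
    rw [hsub i j]
    have hij := congrFun (congrFun h i) j
    rw [hsub', Matrix.zero_apply, ZMod.intCast_zmod_eq_zero_iff_dvd] at hij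
    exact (intCast_mem_levelIdeal_iff hN).2 hij

omit [Fintype n] [DecidableEq n] in
/-- The double cast `ℤ → ℚ → 𝔸_{ℚ,f}` of an integer matrix is its cast `ℤ → 𝔸_{ℚ,f}`. [cite: Deligne1971TravauxShimura, 0.4 p. 126] -/
theorem map_intCast_map_algebraMap (A : Matrix n n ℤ) :
    (A.map (Int.castRingHom ℚ)).map (algebraMap ℚ finAdeleQ) = A.map (Int.castRingHom finAdeleQ) := by
  rw [Matrix.map_map]
  congr 1
  funext z
  simp

end Integers

/-! ### §2. Integral ⇒ adelic: `M ∈ Γ_δ(N)` iff the rational similitude `M_ℚ` lies in `K_δ(N)` -/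

section IntegralToAdelic

variable {δ : Fin g → ℕ}

/-- The adelic point of the rational similitude `M_ℚ` of an integral symplectic `M ∈ Sp_δ(ℤ)` is the integer matrix `M`
cast into `𝔸_{ℚ,f}`. [cite: Deligne1971TravauxShimura, 0.4 p. 126] -/
theorem coe_gspRationalToFinAdelic_map_intCast {M : GL (Fin g ⊕ Fin g) ℤ} (hM : M ∈ symplecticLatticeGroup δ) :
    ((gspRationalToFinAdelic δ ⟨Matrix.GeneralLinearGroup.map (Int.castRingHom ℚ) M,
        map_mem_gspRational_of_mem_symplecticLatticeGroup δ hM⟩ : GL (Fin g ⊕ Fin g) finAdeleQ) :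
        Matrix (Fin g ⊕ Fin g) (Fin g ⊕ Fin g) finAdeleQ) =
      (M : Matrix (Fin g ⊕ Fin g) (Fin g ⊕ Fin g) ℤ).map (Int.castRingHom finAdeleQ) := by
  rw [coe_gspRationalToFinAdelic]
  exact map_intCast_map_algebraMap _

/-- Same for the inverse. [cite: Deligne1971TravauxShimura, 0.4 p. 126] -/
theorem coe_gspRationalToFinAdelic_map_intCast_inv {M : GL (Fin g ⊕ Fin g) ℤ} (hM : M ∈ symplecticLatticeGroup δ) :
    (((gspRationalToFinAdelic δ ⟨Matrix.GeneralLinearGroup.map (Int.castRingHom ℚ) M,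
        map_mem_gspRational_of_mem_symplecticLatticeGroup δ hM⟩ : GL (Fin g ⊕ Fin g) finAdeleQ)⁻¹ :
          GL (Fin g ⊕ Fin g) finAdeleQ) : Matrix (Fin g ⊕ Fin g) (Fin g ⊕ Fin g) finAdeleQ) =
      ((M⁻¹ : GL (Fin g ⊕ Fin g) ℤ) : Matrix (Fin g ⊕ Fin g) (Fin g ⊕ Fin g) ℤ).map (Int.castRingHom finAdeleQ) := by
  rw [coe_gspRationalToFinAdelic, ← map_inv, ← map_inv]
  exact map_intCast_map_algebraMap _

/-- **Integral ⇒ adelic dictionary**: for `M ∈ Sp_δ(ℤ)` and `N ≠ 0`, the rational similitude `M_ℚ ∈ GSp_δ(ℚ)` lies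
(adelically) in the principal level `K_δ(N)` iff `M ∈ Γ_δ(N)` («`Γ_n = {A ∈ Sp(2g, ℤ) | A ≡ I_{2g} (mod n)}`»).
[cite: MumfordFogartyKirwan1994, Appendix to Ch. 7 §A] [cite: Deligne1971TravauxShimura, Exemple 4.16 p. 150] -/
theorem map_mem_principalLevelSubgroup_iff_mem_siegelLevelGroup {N : ℕ} (hN : N ≠ 0)
    {M : GL (Fin g ⊕ Fin g) ℤ} (hM : M ∈ symplecticLatticeGroup δ) :
    gspRationalToFinAdelic δ ⟨Matrix.GeneralLinearGroup.map (Int.castRingHom ℚ) M,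
        map_mem_gspRational_of_mem_symplecticLatticeGroup δ hM⟩ ∈ principalLevelSubgroup δ N ↔
      M ∈ siegelLevelGroup δ N := by
  rw [mem_principalLevelSubgroup_iff, coe_gspRationalToFinAdelic_map_intCast hM,
    coe_gspRationalToFinAdelic_map_intCast_inv hM, isCongOne_map_intCast_iff hN, isCongOne_map_intCast_iff hN]
  constructor
  · rintro ⟨h1, -⟩
    exact ⟨hM, h1⟩
  · intro h
    exact ⟨h.2, (mem_siegelLevelGroup_iff.1 (inv_mem h)).2⟩

end IntegralToAdelic

/-! ### §3. Adelic ⇒ integral: a rational similitude in `K_δ(N)`, `N ≥ 3`, is an integral symplectic matrix `≡ 1 (mod N)` -/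

section AdelicToIntegral

variable {δ : Fin g → ℕ}

/-- A rational invertible matrix which, read in `GL_n(𝔸_{ℚ,f})`, is `≡ 1 (mod N·𝓞̂)` together with its inverse is an
INTEGER invertible matrix: `ℚ ∩ ℤ̂ = ℤ` entrywise for `γ` and `γ⁻¹`. [cite: Deligne1971TravauxShimura, 0.4 p. 126 and Exemple 4.16 p. 150] -/
theorem exists_map_intCast_eq_of_isCongOne {n : Type} [Fintype n] [DecidableEq n] {N : ℕ} (γ : GL n ℚ)
    (h : IsCongOne N ((Matrix.GeneralLinearGroup.map (algebraMap ℚ finAdeleQ) γ : GL n finAdeleQ) : Matrix n n finAdeleQ))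
    (h' : IsCongOne N (((Matrix.GeneralLinearGroup.map (algebraMap ℚ finAdeleQ) γ)⁻¹ : GL n finAdeleQ) :
      Matrix n n finAdeleQ)) :
    ∃ M : GL n ℤ, Matrix.GeneralLinearGroup.map (Int.castRingHom ℚ) M = γ := by
  -- entries of `γ` and `γ⁻¹` are integers
  have hA : ∀ i j, ∃ z : ℤ, (z : ℚ) = (γ : Matrix n n ℚ) i j := fun i j =>
    exists_int_cast_eq_of_algebraMap_mem_integralAdeles (mem_integralAdeles_of_isCongOne h i j)
  have hB : ∀ i j, ∃ z : ℤ, (z : ℚ) = ((γ⁻¹ : GL n ℚ) : Matrix n n ℚ) i j := fun i j => by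
    refine exists_int_cast_eq_of_algebraMap_mem_integralAdeles ?_
    have := mem_integralAdeles_of_isCongOne h' i j
    rw [← map_inv] at this
    exact this
  choose A hA using hA
  choose B hB using hB
  have hAq : (Matrix.of A).map (Int.castRingHom ℚ) = (γ : Matrix n n ℚ) := by
    ext i j; simp [hA i j]
  have hBq : (Matrix.of B).map (Int.castRingHom ℚ) = ((γ⁻¹ : GL n ℚ) : Matrix n n ℚ) := by
    ext i j; simp [hB i j]
  have hinj : Function.Injective (fun X : Matrix n n ℤ => X.map (Int.castRingHom ℚ)) :=
    fun X Y hXY => by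
      ext i j
      have := congrFun (congrFun hXY i) j
      simpa using this
  have hAB : Matrix.of A * Matrix.of B = 1 := hinj (by
    simp only [Matrix.map_mul, hAq, hBq, Matrix.map_one (Int.castRingHom ℚ) (map_zero _) (map_one _),
      ← Units.val_mul, mul_inv_cancel, Units.val_one])
  have hBA : Matrix.of B * Matrix.of A = 1 := hinj (by
    simp only [Matrix.map_mul, hAq, hBq, Matrix.map_one (Int.castRingHom ℚ) (map_zero _) (map_one _),
      ← Units.val_mul, inv_mul_cancel, Units.val_one])
  exact ⟨⟨Matrix.of A, Matrix.of B, hAB, hBA⟩, Units.ext hAq⟩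

/-- `E_δ` over `ℚ` has non-zero determinant (`E_δ² = -diag(Δ², Δ²)`, `δᵢ ≥ 1`). [cite: GenestierNgo2020, §1.2] -/
theorem det_typeFormOver_rat_ne_zero (hδ : ∀ i, 0 < δ i) : (typeFormOver δ ℚ).det ≠ 0 := by
  have hE : typeFormOver δ ℚ = Matrix.fromBlocks 0 (Matrix.diagonal fun i => (δ i : ℚ))
      (-Matrix.diagonal fun i => (δ i : ℚ)) 0 := by
    simp [typeFormOver, typeForm, Matrix.fromBlocks_map, Matrix.diagonal_map]
  have hsq : typeFormOver δ ℚ * typeFormOver δ ℚ =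
      Matrix.fromBlocks (-(Matrix.diagonal fun i => (δ i : ℚ) * δ i)) 0 0 (-(Matrix.diagonal fun i => (δ i : ℚ) * δ i)) := by
    rw [hE, Matrix.fromBlocks_multiply]
    simp [Matrix.diagonal_mul_diagonal]
  have hD : (Matrix.diagonal fun i => (δ i : ℚ) * δ i).det ≠ 0 := by
    rw [Matrix.det_diagonal]
    exact Finset.prod_ne_zero_iff.2 fun i _ => mul_ne_zero (Nat.cast_ne_zero.2 (hδ i).ne') (Nat.cast_ne_zero.2 (hδ i).ne')
  intro h0
  have := congrArg Matrix.det hsq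
  rw [Matrix.det_mul, h0, zero_mul, Matrix.det_fromBlocks_zero₂₁, Matrix.det_neg] at this
  exact (mul_ne_zero (mul_ne_zero (pow_ne_zero _ (by norm_num)) hD) (mul_ne_zero (pow_ne_zero _ (by norm_num)) hD))
    this.symm

/-- The multiplier of a rational similitude with `det = ±1` satisfies `ν = ±1` (`ν^{2g} det E_δ = det(γ)² det E_δ`).
[cite: Milne2005ShimuraVarieties, §6 p. 67] -/
theorem multiplier_eq_one_or_eq_neg_one_of_det (hδ : ∀ i, 0 < δ i) (hg : 0 < g) {γ : GL (Fin g ⊕ Fin g) ℚ} {ν : ℚˣ}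
    (hν : IsMultiplier (typeFormOver δ ℚ) γ ν)
    (hdet : (γ : Matrix (Fin g ⊕ Fin g) (Fin g ⊕ Fin g) ℚ).det = 1 ∨ (γ : Matrix (Fin g ⊕ Fin g) (Fin g ⊕ Fin g) ℚ).det = -1) :
    (ν : ℚ) = 1 ∨ (ν : ℚ) = -1 := by
  have h := congrArg Matrix.det (isMultiplier_iff.1 hν)
  rw [Matrix.det_mul, Matrix.det_mul, Matrix.det_transpose, Matrix.det_smul, Fintype.card_sum, Fintype.card_fin] at h
  have hdet2 : (γ : Matrix (Fin g ⊕ Fin g) (Fin g ⊕ Fin g) ℚ).det * (γ : Matrix (Fin g ⊕ Fin g) (Fin g ⊕ Fin g) ℚ).det = 1 := by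
    rcases hdet with h1 | h1 <;> rw [h1] <;> norm_num
  have hpow : (ν : ℚ) ^ (g + g) = 1 := by
    have h' : (γ : Matrix (Fin g ⊕ Fin g) (Fin g ⊕ Fin g) ℚ).det * (γ : Matrix (Fin g ⊕ Fin g) (Fin g ⊕ Fin g) ℚ).det *
        (typeFormOver δ ℚ).det = (ν : ℚ) ^ (g + g) * (typeFormOver δ ℚ).det := by
      rw [← h]; ring
    rw [hdet2] at h'
    exact (mul_right_cancel₀ (det_typeFormOver_rat_ne_zero hδ) h').symm
  have hsq : ((ν : ℚ) * ν) ^ g = 1 := by rw [← pow_two, ← pow_mul, two_mul]; exact hpow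
  have h1 : (ν : ℚ) * ν = 1 := (pow_eq_one_iff_of_nonneg (mul_self_nonneg _) hg.ne').1 hsq
  exact mul_self_eq_one_iff.1 h1

/-- Casting integer matrices to rational matrices is injective. [folklore] -/
private theorem map_intCast_rat_injective {n : Type} :
    Function.Injective (fun X : Matrix n n ℤ => X.map (Int.castRingHom ℚ)) := fun X Y hXY => by
  ext i j
  have := congrFun (congrFun hXY i) j
  simpa using this

/-- `GL_n(ℤ) → GL_n(ℚ)` is injective — so the integral lift `M ∈ Γ_δ(N)` of §3 is UNIQUE («`Γ = K(N) ∩ G(ℚ)`» is an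
honest intersection). [cite: Deligne1971TravauxShimura, 0.4 p. 126 and Exemple 4.16 p. 150] -/
theorem generalLinearGroup_map_intCast_injective {n : Type} [Fintype n] [DecidableEq n] :
    Function.Injective (Matrix.GeneralLinearGroup.map (n := n) (Int.castRingHom ℚ)) := fun _ _ hXY =>
  Units.ext (map_intCast_rat_injective (congrArg (fun u : GL n ℚ => (u : Matrix n n ℚ)) hXY))

/-- **Reduction to `δ₀ = 1`**: for a polarisation type `δ` and `0 < g`, `E_δ = δ₀ • E_{δ/δ₀}` where `(δ/δ₀)ᵢ = δᵢ/δ₀`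
(`δ₀ ∣ δᵢ`), and `(δ/δ₀)₀ = 1`. [cite: GenestierNgo2020, §1.2 (type D = (d₁ | d₂ | ⋯ | d_g))] -/
theorem typeForm_eq_smul_typeForm_div (hδ : IsPolarizationType δ) (hg : 0 < g) :
    typeForm δ = (δ ⟨0, hg⟩ : ℤ) • typeForm (fun i => δ i / δ ⟨0, hg⟩) := by
  have hdiv : ∀ i : Fin g, δ ⟨0, hg⟩ * (δ i / δ ⟨0, hg⟩) = δ i := fun i =>
    Nat.mul_div_cancel' (hδ.2 ⟨0, hg⟩ i (Fin.le_iff_val_le_val.2 (Nat.zero_le _)))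
  have hdiag : (Matrix.diagonal fun i => (δ i : ℤ)) =
      (δ ⟨0, hg⟩ : ℤ) • Matrix.diagonal fun i => ((δ i / δ ⟨0, hg⟩ : ℕ) : ℤ) := by
    rw [← Matrix.diagonal_smul]
    congr 1
    funext i
    rw [Pi.smul_apply, smul_eq_mul, ← Nat.cast_mul, hdiv i]
  rw [typeForm, typeForm, Matrix.fromBlocks_smul, smul_zero, smul_neg, ← hdiag]

/-- **The multiplier is `≡ 1 (mod N)`**: if an integer matrix `A` reduces to `1` modulo `N` and `ᵗA E_δ A = ν E_δ`
with `ν ∈ ℤ` (`δ` a polarisation type, `0 < g`), then `ν ≡ 1 (mod N)` — read the `(0, g)` entry of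
`ᵗA E_{δ/δ₀} A = ν E_{δ/δ₀}` modulo `N`, where `E_{δ/δ₀}` has entry `1`.  (The multiplier side of
«`K(N) = {g ≡ 1 mod N}`»; cf. R60-4 for the adelic `ν(K_δ(N)) ⊆ 1 + Nẑ`.) [cite: Deligne1971TravauxShimura, Exemple 4.16 p. 150]
[cite: Milne2005ShimuraVarieties, §6 p. 67] -/
theorem intCast_multiplier_zmod_eq_one (hδ : IsPolarizationType δ) (hg : 0 < g) {N : ℕ}
    {A : Matrix (Fin g ⊕ Fin g) (Fin g ⊕ Fin g) ℤ} (hA : A.map (Int.castRingHom (ZMod N)) = 1) {ν : ℤ}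
    (hν : Aᵀ * typeForm δ * A = ν • typeForm δ) : (ν : ZMod N) = 1 := by
  have h0 : (δ ⟨0, hg⟩ : ℤ) ≠ 0 := Nat.cast_ne_zero.2 (hδ.1 ⟨0, hg⟩).ne'
  -- cancel `δ₀`
  have h1 := hν
  rw [typeForm_eq_smul_typeForm_div hδ hg, Matrix.mul_smul, Matrix.smul_mul, smul_comm ν] at h1
  set ε : Fin g → ℕ := fun i => δ i / δ ⟨0, hg⟩ with hε
  have h2 : Aᵀ * typeForm ε * A = ν • typeForm ε := by
    ext i j
    have := congrFun (congrFun h1 i) j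
    simp only [Matrix.smul_apply, smul_eq_mul] at this
    have := mul_left_cancel₀ h0 this
    simpa only [Matrix.smul_apply, smul_eq_mul] using this
  -- read the `(inl 0, inr 0)` entry modulo `N`
  have hε0' : ε ⟨0, hg⟩ = 1 := Nat.div_self (hδ.1 ⟨0, hg⟩)
  have hε0 : typeForm ε (Sum.inl ⟨0, hg⟩) (Sum.inr ⟨0, hg⟩) = 1 := by
    simp only [typeForm, Matrix.fromBlocks_apply₁₂, Matrix.diagonal_apply_eq, hε0', Nat.cast_one]
  have h3 := congrArg (fun X : Matrix (Fin g ⊕ Fin g) (Fin g ⊕ Fin g) ℤ => (X.map (Int.castRingHom (ZMod N)))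
    (Sum.inl ⟨0, hg⟩) (Sum.inr ⟨0, hg⟩)) h2
  rw [Matrix.map_mul, Matrix.map_mul, Matrix.transpose_map, hA, transpose_one, Matrix.one_mul, Matrix.mul_one,
    Matrix.map_apply, hε0, map_one, Matrix.map_apply, Matrix.smul_apply, hε0, smul_eq_mul, mul_one, eq_intCast] at h3
  exact h3.symm

/-- **ADELIC ⇒ INTEGRAL: `GSp_δ(ℚ) ∩ K_δ(N) ⊆ Γ_δ(N)`** — for `N ≥ 3`, `0 < g`, `δ` a polarisation type, a rational
similitude `γ ∈ GSp_δ(ℚ)` whose finite-adelic point lies in the principal level `K_δ(N)` is (the rational point of)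
an INTEGRAL symplectic matrix `M ∈ Γ_δ(N) = {M ∈ Sp_δ(ℤ) | M ≡ 1 (mod N)}`: entries of `γ, γ⁻¹` lie in `ℚ ∩ ℤ̂ = ℤ`,
`det γ = ±1`, so the multiplier `ν` has `ν^{2g} = 1`, `ν = ±1`; `ν ≡ 1 (mod N)` excludes `ν = -1` as `N ≥ 3`.
([Deligne 1971] 4.16 «`Γ = K(N) ∩ G(ℚ)`»; [MFK94] App. 7A «`Γ_n = {A ∈ Sp(2g,ℤ) | A ≡ 1 (mod n)}`»; [Milne ISV] Lemma 5.13
footnote 40, the step «we find that `q ∈ Γ_g`».)  The `M` is unique (`generalLinearGroup_map_intCast_injective`).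
[cite: Deligne1971TravauxShimura, Exemple 4.16 p. 150] [cite: MumfordFogartyKirwan1994, Appendix to Ch. 7 §A]
[cite: Milne2005ShimuraVarieties, Lemma 5.13 p. 57] -/
theorem exists_siegelLevelGroup_map_eq_of_mem_principalLevelSubgroup (hδ : IsPolarizationType δ) (hg : 0 < g)
    {N : ℕ} (hN : 3 ≤ N) (γ : gspRational δ) (h : gspRationalToFinAdelic δ γ ∈ principalLevelSubgroup δ N) :
    ∃ M : GL (Fin g ⊕ Fin g) ℤ, M ∈ siegelLevelGroup δ N ∧
      Matrix.GeneralLinearGroup.map (Int.castRingHom ℚ) M = (γ : GL (Fin g ⊕ Fin g) ℚ) := by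
  have hN0 : N ≠ 0 := by omega
  obtain ⟨h1, h2⟩ := (mem_principalLevelSubgroup_iff δ).1 h
  rw [coe_gspRationalToFinAdelic] at h1
  change IsCongOne N (((Matrix.GeneralLinearGroup.map (algebraMap ℚ finAdeleQ) (γ : GL (Fin g ⊕ Fin g) ℚ))⁻¹ :
    GL (Fin g ⊕ Fin g) finAdeleQ) : Matrix (Fin g ⊕ Fin g) (Fin g ⊕ Fin g) finAdeleQ) at h2
  -- integrality of `γ`, `γ⁻¹`
  obtain ⟨M, hM⟩ := exists_map_intCast_eq_of_isCongOne (γ : GL (Fin g ⊕ Fin g) ℚ) h1 h2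
  have hMq : (M : Matrix (Fin g ⊕ Fin g) (Fin g ⊕ Fin g) ℤ).map (Int.castRingHom ℚ) =
      ((γ : GL (Fin g ⊕ Fin g) ℚ) : Matrix (Fin g ⊕ Fin g) (Fin g ⊕ Fin g) ℚ) :=
    congrArg (fun u : GL (Fin g ⊕ Fin g) ℚ => (u : Matrix (Fin g ⊕ Fin g) (Fin g ⊕ Fin g) ℚ)) hM
  -- `det γ = ±1`
  have hdet := det_eq_one_or_eq_neg_one_of_isCongOne (γ : GL (Fin g ⊕ Fin g) ℚ) 1
    (by rw [inv_one, one_mul, mul_one]; exact h1) (by rw [inv_one, one_mul, mul_one]; exact h2)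
  -- the multiplier is `±1`
  obtain ⟨ν, hν⟩ := γ.2
  have e := isMultiplier_iff.1 hν
  rw [typeFormOver, ← hMq, ← Matrix.transpose_map, ← Matrix.map_mul, ← Matrix.map_mul] at e
  -- congruence of `M` modulo `N`
  change IsCongOne N ((((γ : GL (Fin g ⊕ Fin g) ℚ)) : Matrix (Fin g ⊕ Fin g) (Fin g ⊕ Fin g) ℚ).map
    (algebraMap ℚ finAdeleQ)) at h1
  rw [← hMq, map_intCast_map_algebraMap, isCongOne_map_intCast_iff hN0] at h1
  rcases multiplier_eq_one_or_eq_neg_one_of_det hδ.1 hg hν hdet with hν1 | hν1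
  · -- `ν = 1`: `M ∈ Sp_δ(ℤ)` and `M ≡ 1 (mod N)`
    have hint : (M : Matrix (Fin g ⊕ Fin g) (Fin g ⊕ Fin g) ℤ)ᵀ * typeForm δ * M = typeForm δ := by
      apply map_intCast_rat_injective
      change ((M : Matrix (Fin g ⊕ Fin g) (Fin g ⊕ Fin g) ℤ)ᵀ * typeForm δ * M).map (Int.castRingHom ℚ) =
        (typeForm δ).map (Int.castRingHom ℚ)
      rw [e, hν1, one_smul]
    exact ⟨M, ⟨hint, h1⟩, hM⟩
  · -- `ν = -1` contradicts `ν ≡ 1 (mod N)`, `N ≥ 3`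
    exfalso
    have hint : (M : Matrix (Fin g ⊕ Fin g) (Fin g ⊕ Fin g) ℤ)ᵀ * typeForm δ * M = (-1 : ℤ) • typeForm δ := by
      apply map_intCast_rat_injective
      change ((M : Matrix (Fin g ⊕ Fin g) (Fin g ⊕ Fin g) ℤ)ᵀ * typeForm δ * M).map (Int.castRingHom ℚ) =
        ((-1 : ℤ) • typeForm δ).map (Int.castRingHom ℚ)
      rw [e, hν1]
      ext i j
      simp
    have h3 := intCast_multiplier_zmod_eq_one hδ hg h1 hint
    rw [Int.cast_neg, Int.cast_one, neg_eq_iff_add_eq_zero, one_add_one_eq_two] at h3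
    have h4 : ((2 : ℕ) : ZMod N) = 0 := by exact_mod_cast h3
    rw [ZMod.natCast_eq_zero_iff] at h4
    have := Nat.le_of_dvd (by norm_num) h4
    omega

/-- **`GSp_δ(ℚ) ∩ K_δ(N) = Γ_δ(N)`** (`N ≥ 3`, `0 < g`, `δ` a polarisation type): a rational similitude lies adelically in
the principal level `K_δ(N)` iff it is the rational point of some (unique) `M ∈ Γ_δ(N) ≤ Sp_δ(ℤ)`.
[cite: Deligne1971TravauxShimura, Exemple 4.16 p. 150] [cite: MumfordFogartyKirwan1994, Appendix to Ch. 7 §A] -/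
theorem mem_principalLevelSubgroup_iff_exists_siegelLevelGroup (hδ : IsPolarizationType δ) (hg : 0 < g)
    {N : ℕ} (hN : 3 ≤ N) (γ : gspRational δ) :
    gspRationalToFinAdelic δ γ ∈ principalLevelSubgroup δ N ↔
      ∃ M : GL (Fin g ⊕ Fin g) ℤ, M ∈ siegelLevelGroup δ N ∧
        Matrix.GeneralLinearGroup.map (Int.castRingHom ℚ) M = (γ : GL (Fin g ⊕ Fin g) ℚ) := by
  refine ⟨exists_siegelLevelGroup_map_eq_of_mem_principalLevelSubgroup hδ hg hN γ, ?_⟩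
  rintro ⟨M, hM, hMγ⟩
  have hγ : γ = ⟨Matrix.GeneralLinearGroup.map (Int.castRingHom ℚ) M,
      map_mem_gspRational_of_mem_symplecticLatticeGroup δ hM.1⟩ := Subtype.ext hMγ.symm
  rw [hγ, map_mem_principalLevelSubgroup_iff_mem_siegelLevelGroup (by omega) hM.1]
  exact hM

end AdelicToIntegral

/-! ### §4. Stabilisers of `K_δ(1)`-representatives and the fibres of `Z ↦ [J(Z), r·K_δ(N)]` on `𝔥_g` -/

section Pieces

variable {δ : Fin g → ℕ}

/-- For a representative `r ∈ K_δ(1) = GSp_δ(ℤ̂)` (which normalises `K_δ(N)`, ★ `principalLevelSubgroup_normal_in_one`):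
`r⁻¹ x r ∈ K_δ(N) ↔ x ∈ K_δ(N)` — the stabiliser `rK_δ(N)r⁻¹ ∩ GSp_δ(ℚ)` of Lemma 5.13 does not depend on the integral
representative. [cite: Milne2005ShimuraVarieties, Lemma 5.13 p. 57 («Γ_g = gKg⁻¹ ∩ G(ℚ)»)] [cite: Deligne1971TravauxShimura, Exemple 4.16 p. 150] -/
theorem conj_mem_principalLevelSubgroup_iff_of_mem_one {N : ℕ} {r x : gspFinAdelic δ}
    (hr : r ∈ principalLevelSubgroup δ 1) :
    r⁻¹ * x * r ∈ principalLevelSubgroup δ N ↔ x ∈ principalLevelSubgroup δ N := by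
  constructor
  · intro h
    have := principalLevelSubgroup_normal_in_one δ N hr h
    rwa [show r * (r⁻¹ * x * r) * r⁻¹ = x by group] at this
  · intro h
    have := principalLevelSubgroup_normal_in_one δ N (inv_mem hr) h
    rwa [inv_inv] at this

/-- **Equality of classes with the SAME adelic component** ([Milne ISV] Lemma 5.13 footnote 40 «If `[x, g] = [x′, g]`,
then `x′ = qx` and `g = qgk`»): `[J, rK] = [J′, rK] ↔ ∃ γ ∈ GSp_δ(ℚ), γJ′γ⁻¹ = J ∧ r⁻¹ γ r ∈ K`.
[cite: Milne2005ShimuraVarieties, Lemma 5.13 p. 57, footnote 40] -/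
theorem SiegelShimuraSet.mk_eq_mk_iff_of_right (K : Subgroup (gspFinAdelic δ)) (J J' : C0pm δ) (r : gspFinAdelic δ) :
    SiegelShimuraSet.mk δ K J r = SiegelShimuraSet.mk δ K J' r ↔
      ∃ γ : gspRational δ, conjAct δ (gspRationalToReal δ γ) J' = J ∧ r⁻¹ * gspRationalToFinAdelic δ γ * r ∈ K := by
  rw [SiegelShimuraSet.mk_eq_mk_iff]
  refine exists_congr fun γ => and_congr_right fun _ => ?_
  rw [MulAction.Quotient.smul_mk, QuotientGroup.eq, smul_eq_mul]
  constructor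
  · intro h
    have := inv_mem h
    rwa [show ((gspRationalToFinAdelic δ γ * r)⁻¹ * r)⁻¹ = r⁻¹ * gspRationalToFinAdelic δ γ * r by group] at this
  · intro h
    have := inv_mem h
    rwa [show (r⁻¹ * gspRationalToFinAdelic δ γ * r)⁻¹ = (gspRationalToFinAdelic δ γ * r)⁻¹ * r by group] at this

/-- At principal level with an integral representative `r ∈ K_δ(1)`: `[J, rK_δ(N)] = [J′, rK_δ(N)] ↔ ∃ γ ∈ GSp_δ(ℚ) ∩ K_δ(N)`
(adelically) with `γJ′γ⁻¹ = J`. [cite: Milne2005ShimuraVarieties, Lemma 5.13 p. 57, footnote 40] [cite: Deligne1971TravauxShimura, Exemple 4.16 p. 150] -/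
theorem SiegelShimuraSet.mk_eq_mk_iff_of_mem_one {N : ℕ} (J J' : C0pm δ) {r : gspFinAdelic δ}
    (hr : r ∈ principalLevelSubgroup δ 1) :
    SiegelShimuraSet.mk δ (principalLevelSubgroup δ N) J r = SiegelShimuraSet.mk δ (principalLevelSubgroup δ N) J' r ↔
      ∃ γ : gspRational δ, conjAct δ (gspRationalToReal δ γ) J' = J ∧
        gspRationalToFinAdelic δ γ ∈ principalLevelSubgroup δ N := by
  rw [SiegelShimuraSet.mk_eq_mk_iff_of_right]
  exact exists_congr fun γ => and_congr_right fun _ => conj_mem_principalLevelSubgroup_iff_of_mem_one hr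

/-! #### The real point of `M_ℚ` (`M ∈ Sp_δ(ℤ)`) is Lange's `A_N`, `N = gDHom M`: `M_ℚ · J(Z) = J(gDHom M • Z)` -/

/-- The real point of the rational similitude `M_ℚ` of `M ∈ Sp_δ(ℤ)` is the integer matrix `M` cast into `ℝ`.
[cite: Lange2023AbelianVarietiesComplex, §3.1.4 (3.8) (p0163)] -/
theorem coe_gspRationalToReal_map_intCast {M : GL (Fin g ⊕ Fin g) ℤ} (hM : M ∈ symplecticLatticeGroup δ) :
    ((gspRationalToReal δ ⟨Matrix.GeneralLinearGroup.map (Int.castRingHom ℚ) M,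
        map_mem_gspRational_of_mem_symplecticLatticeGroup δ hM⟩ : GL (Fin g ⊕ Fin g) ℝ) :
        Matrix (Fin g ⊕ Fin g) (Fin g ⊕ Fin g) ℝ) =
      (M : Matrix (Fin g ⊕ Fin g) (Fin g ⊕ Fin g) ℤ).map (Int.cast : ℤ → ℝ) := by
  rw [coe_gspRationalToReal]
  ext i j
  change algebraMap ℚ ℝ (((M : Matrix (Fin g ⊕ Fin g) (Fin g ⊕ Fin g) ℤ) i j : ℤ) : ℚ) =
    (((M : Matrix (Fin g ⊕ Fin g) (Fin g ⊕ Fin g) ℤ) i j : ℤ) : ℝ)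
  exact map_intCast (algebraMap ℚ ℝ) _

/-- **`A_{gDHom M} = M_ℝ`**: Lange's `A_N = M_N⁻¹ ∈ Sp(V, E_δ)(ℝ)` (★ `toSpForm`) at `N = gDHom M ∈ Sp_{2g}(ℝ)`
(★ `SiegelModuliRelation.gDHom`, `N = (toGD M)⁻¹`) is the integer matrix `M ∈ Sp_δ(ℤ)` itself
(`M_N = diag(1,Δ)⁻¹ ᵗN diag(1,Δ) = M⁻¹`). [cite: Lange2023AbelianVarietiesComplex, §3.1.4 (3.8) and Remark 3.1.14 (p0163); §7.1.2 Lemma 7.1.7 (p0327)] -/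
theorem coe_toSpForm_gDHom (hδ : ∀ i, 0 < δ i) (M : symplecticLatticeGroup δ) :
    ((toSpForm hδ (gDHom δ hδ M) : GL (Fin g ⊕ Fin g) ℝ) : Matrix (Fin g ⊕ Fin g) (Fin g ⊕ Fin g) ℝ) =
      ((M : GL (Fin g ⊕ Fin g) ℤ) : Matrix (Fin g ⊕ Fin g) (Fin g ⊕ Fin g) ℤ).map (Int.cast : ℤ → ℝ) := by
  have hrat : ratRep δ (gDHom δ hδ M : Matrix (Fin g ⊕ Fin g) (Fin g ⊕ Fin g) ℝ) =
      (((M⁻¹ : symplecticLatticeGroup δ) : GL (Fin g ⊕ Fin g) ℤ) : Matrix (Fin g ⊕ Fin g) (Fin g ⊕ Fin g) ℤ).map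
        (Int.cast : ℤ → ℝ) := by
    rw [ratRep, coe_gDHom, toGD_def, transpose_transpose]
    calc typeDiagInv δ * (typeDiag δ * (((M⁻¹ : symplecticLatticeGroup δ) : GL (Fin g ⊕ Fin g) ℤ) :
            Matrix (Fin g ⊕ Fin g) (Fin g ⊕ Fin g) ℤ).map (Int.cast : ℤ → ℝ) * typeDiagInv δ) * typeDiag δ
        = (typeDiagInv δ * typeDiag δ) * (((M⁻¹ : symplecticLatticeGroup δ) : GL (Fin g ⊕ Fin g) ℤ) :
            Matrix (Fin g ⊕ Fin g) (Fin g ⊕ Fin g) ℤ).map (Int.cast : ℤ → ℝ) * (typeDiagInv δ * typeDiag δ) := by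
          simp only [Matrix.mul_assoc]
      _ = _ := by rw [typeDiagInv_mul_typeDiag hδ, Matrix.one_mul, Matrix.mul_one]
  have hMM : ((M : GL (Fin g ⊕ Fin g) ℤ) : Matrix (Fin g ⊕ Fin g) (Fin g ⊕ Fin g) ℤ).map (Int.cast : ℤ → ℝ) *
      (((M⁻¹ : symplecticLatticeGroup δ) : GL (Fin g ⊕ Fin g) ℤ) : Matrix (Fin g ⊕ Fin g) (Fin g ⊕ Fin g) ℤ).map
        (Int.cast : ℤ → ℝ) = 1 := by
    rw [Subgroup.coe_inv, show ((M : GL (Fin g ⊕ Fin g) ℤ) : Matrix (Fin g ⊕ Fin g) (Fin g ⊕ Fin g) ℤ).map (Int.cast : ℤ → ℝ) *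
        (((M : GL (Fin g ⊕ Fin g) ℤ)⁻¹ : GL (Fin g ⊕ Fin g) ℤ) : Matrix (Fin g ⊕ Fin g) (Fin g ⊕ Fin g) ℤ).map (Int.cast : ℤ → ℝ) =
        (((M : GL (Fin g ⊕ Fin g) ℤ) : Matrix (Fin g ⊕ Fin g) (Fin g ⊕ Fin g) ℤ) *
          (((M : GL (Fin g ⊕ Fin g) ℤ)⁻¹ : GL (Fin g ⊕ Fin g) ℤ) : Matrix (Fin g ⊕ Fin g) (Fin g ⊕ Fin g) ℤ)).map
            (Int.cast : ℤ → ℝ) from (Matrix.map_mul (f := Int.castRingHom ℝ)).symm,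
      Units.mul_inv, Matrix.map_one _ Int.cast_zero Int.cast_one]
  rw [coe_toSpForm, hrat]
  exact Matrix.inv_eq_left_inv hMM

/-- As elements of `GL_{2g}(ℝ)`: the real point of `M_ℚ` IS `toSpForm (gDHom M)`. [cite: Lange2023AbelianVarietiesComplex, §7.1.2 Lemma 7.1.7 (p0327)] -/
theorem gspRationalToReal_map_intCast_eq_toSpForm (hδ : ∀ i, 0 < δ i) (M : symplecticLatticeGroup δ) :
    (gspRationalToReal δ ⟨Matrix.GeneralLinearGroup.map (Int.castRingHom ℚ) (M : GL (Fin g ⊕ Fin g) ℤ),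
        map_mem_gspRational_of_mem_symplecticLatticeGroup δ M.2⟩ : GL (Fin g ⊕ Fin g) ℝ) =
      (toSpForm hδ (gDHom δ hδ M) : GL (Fin g ⊕ Fin g) ℝ) :=
  Units.ext (by rw [coe_gspRationalToReal_map_intCast M.2, coe_toSpForm_gDHom hδ M])

/-- `J(Z) ∈ S^±` for `Z ∈ 𝔥_g` (the `+` half). [cite: Milne2005ShimuraVarieties, §6 p. 68] -/
theorem jOfSiegel_coe_mem_C0pm (hδ : ∀ i, 0 < δ i) (Z : siegelUpperHalfSpace g) :
    jOfSiegel δ (Z : Matrix (Fin g) (Fin g) ℂ) ∈ C0pm δ :=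
  C0_subset_C0pm δ (jOfSiegel_mem_C0 hδ Z.2)

/-- **Equivariance ([Lange 2023] Lemma 7.1.7 read for integral elements): `M_ℚ · J(Z) = J(gDHom M • Z)`** — the rational
similitude of `M ∈ Sp_δ(ℤ)`, acting on `S^±` by conjugation through its real point, moves Lange's complex structure
`J(Z)` of `Z ∈ 𝔥_g` to that of the Möbius image `gDHom M • Z` (★ `jOfSiegel_smul`, ★ `c0EquivSiegel_symm_smul`).
[cite: Lange2023AbelianVarietiesComplex, §7.1.2 Lemma 7.1.7 (p0328); §3.1.4 Remark 3.1.14 (p0163)] -/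
theorem conjAct_map_intCast_jOfSiegel (hδ : ∀ i, 0 < δ i) (M : symplecticLatticeGroup δ) (Z : siegelUpperHalfSpace g) :
    conjAct δ (gspRationalToReal δ ⟨Matrix.GeneralLinearGroup.map (Int.castRingHom ℚ) (M : GL (Fin g ⊕ Fin g) ℤ),
        map_mem_gspRational_of_mem_symplecticLatticeGroup δ M.2⟩) ⟨jOfSiegel δ Z, jOfSiegel_coe_mem_C0pm hδ Z⟩ =
      ⟨jOfSiegel δ ((gDHom δ hδ M • Z : siegelUpperHalfSpace g) : Matrix (Fin g) (Fin g) ℂ),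
        jOfSiegel_coe_mem_C0pm hδ (gDHom δ hδ M • Z)⟩ := by
  apply Subtype.ext
  rw [coe_conjAct, conjJ_def, gspRationalToReal_map_intCast_eq_toSpForm hδ M]
  have h := congrArg Subtype.val (c0EquivSiegel_symm_smul hδ (gDHom δ hδ M) Z)
  rw [coe_c0EquivSiegel_symm, coe_smul_C0, coe_c0EquivSiegel_symm] at h
  exact h.symm

/-- `Z ↦ J(Z)` is injective on `𝔥_g` (Lange's bijection `C₀ ≃ 𝔥_g`, ★ `c0EquivSiegel`). [cite: Lange2023AbelianVarietiesComplex, §7.1.2 (7.2) and Lemma 7.1.6 (p0327)] -/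
theorem jOfSiegel_coe_injective (hδ : ∀ i, 0 < δ i) {Z Z' : siegelUpperHalfSpace g}
    (h : jOfSiegel δ (Z : Matrix (Fin g) (Fin g) ℂ) = jOfSiegel δ (Z' : Matrix (Fin g) (Fin g) ℂ)) : Z = Z' := by
  apply (c0EquivSiegel hδ).symm.injective
  apply Subtype.ext
  rw [coe_c0EquivSiegel_symm, coe_c0EquivSiegel_symm]
  exact h

/-- **HEAD — the fibres of `Z ↦ [J(Z), r·K_δ(N)]` on `𝔥_g` are the `Γ_δ(N)`-orbits** ([Milne ISV] Lemma 5.13, injectivity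
half, for `GSp_δ` at principal level): for `N ≥ 3`, `0 < g`, `δ` a polarisation type, an integral representative
`r ∈ K_δ(1)` and `Z, Z′ ∈ 𝔥_g`:
`[J(Z), rK_δ(N)] = [J(Z′), rK_δ(N)] ↔ ∃ M ∈ Γ_δ(N), Z = gDHom M • Z′` — in EXACTLY the Möbius currency of
★ `SiegelModuliDatum.unif_eq_unif_iff_exists_smul` (the moduli relation of a Siegel fine moduli datum of level `N`).
Proof: `→` by `mk_eq_mk_iff_of_mem_one`, the adelic ⇒ integral dictionary of §3 and the equivariance
`M_ℚ · J(Z′) = J(gDHom M • Z′)` with injectivity of `Z ↦ J(Z)`; `←` by §2 and the same equivariance.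
[cite: Milne2005ShimuraVarieties, Lemma 5.13 p. 57 (footnote 40)] [cite: Deligne1971TravauxShimura, Exemple 4.16 p. 150]
[cite: Lange2023AbelianVarietiesComplex, §7.1.2 Lemma 7.1.7 (p0328)] -/
theorem SiegelShimuraSet.mk_jOfSiegel_eq_mk_jOfSiegel_iff (hδ : IsPolarizationType δ) (hg : 0 < g) {N : ℕ} (hN : 3 ≤ N)
    {r : gspFinAdelic δ} (hr : r ∈ principalLevelSubgroup δ 1) (Z Z' : siegelUpperHalfSpace g) :
    SiegelShimuraSet.mk δ (principalLevelSubgroup δ N) ⟨jOfSiegel δ Z, jOfSiegel_coe_mem_C0pm hδ.1 Z⟩ r =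
        SiegelShimuraSet.mk δ (principalLevelSubgroup δ N) ⟨jOfSiegel δ Z', jOfSiegel_coe_mem_C0pm hδ.1 Z'⟩ r ↔
      ∃ M : symplecticLatticeGroup δ, (M : GL (Fin g ⊕ Fin g) ℤ) ∈ siegelLevelGroup δ N ∧ Z = gDHom δ hδ.1 M • Z' := by
  rw [SiegelShimuraSet.mk_eq_mk_iff_of_mem_one _ _ hr]
  constructor
  · rintro ⟨γ, hγJ, hγN⟩
    obtain ⟨M, hM, hMγ⟩ := exists_siegelLevelGroup_map_eq_of_mem_principalLevelSubgroup hδ hg hN γ hγN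
    have hγ : γ = ⟨Matrix.GeneralLinearGroup.map (Int.castRingHom ℚ) M,
        map_mem_gspRational_of_mem_symplecticLatticeGroup δ hM.1⟩ := Subtype.ext hMγ.symm
    refine ⟨⟨M, hM.1⟩, hM, ?_⟩
    rw [hγ] at hγJ
    have h := (conjAct_map_intCast_jOfSiegel hδ.1 ⟨M, hM.1⟩ Z').symm.trans hγJ
    exact (jOfSiegel_coe_injective hδ.1 (congrArg Subtype.val h)).symm
  · rintro ⟨M, hM, hZ⟩
    refine ⟨⟨Matrix.GeneralLinearGroup.map (Int.castRingHom ℚ) (M : GL (Fin g ⊕ Fin g) ℤ),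
        map_mem_gspRational_of_mem_symplecticLatticeGroup δ M.2⟩, ?_,
      (map_mem_principalLevelSubgroup_iff_mem_siegelLevelGroup (by omega) M.2).2 hM⟩
    rw [conjAct_map_intCast_jOfSiegel hδ.1 M Z']
    exact Subtype.ext (by rw [hZ])

/-- **The fibres of `Z ↦ [J(Z), r·K_δ(N)]` are the fibres of the uniformisation of ANY Siegel fine moduli datum of type
`δ` and level `N`**: `[J(Z), rK_δ(N)] = [J(Z′), rK_δ(N)] ↔ D.unif Z′ = D.unif Z` (★ `SiegelModuliDatum.unif_eq_unif_iff_exists_smul`,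
the moduli property «`S(ℂ) = Γ_δ(N)∖𝔥_g`», [GenestierNgo2020] Prop. 1.3.2 / [MFK94] App. 7A «`𝒜*_{g,1,n} × Spec ℂ ≅ 𝔥_g/Γ_n`»).
[cite: GenestierNgo2020, Prop. 1.3.2] [cite: MumfordFogartyKirwan1994, Appendix to Ch. 7 §A] [cite: Milne2005ShimuraVarieties, Lemma 5.13 p. 57] -/
theorem SiegelShimuraSet.mk_jOfSiegel_eq_mk_jOfSiegel_iff_unif_eq_unif (hδ : IsPolarizationType δ) (hg : 0 < g) {N : ℕ}
    (hN : 3 ≤ N) (D : SiegelModuliDatum g δ N) {r : gspFinAdelic δ} (hr : r ∈ principalLevelSubgroup δ 1)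
    (Z Z' : siegelUpperHalfSpace g) :
    SiegelShimuraSet.mk δ (principalLevelSubgroup δ N) ⟨jOfSiegel δ Z, jOfSiegel_coe_mem_C0pm hδ.1 Z⟩ r =
        SiegelShimuraSet.mk δ (principalLevelSubgroup δ N) ⟨jOfSiegel δ Z', jOfSiegel_coe_mem_C0pm hδ.1 Z'⟩ r ↔
      D.unif Z' = D.unif Z := by
  rw [SiegelShimuraSet.mk_jOfSiegel_eq_mk_jOfSiegel_iff hδ hg hN hr, D.unif_eq_unif_iff_exists_smul hδ.1 Z'.2 Z.2]

/-- **The piece map `S(ℂ) = Γ_δ(N)∖𝔥_g ↪ Sh_{K_δ(N)}(GSp_δ, S^±)(ℂ)`, `[X_Z] ↦ [J(Z), r·K_δ(N)]`, exists and is injective**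
for every Siegel fine moduli datum `D` of type `δ`, level `N ≥ 3`, and every integral representative `r ∈ K_δ(1)`
(the injectivity half of [Milne ISV] Lemma 5.13 in the form consumed by ★ (σ3) `SiegelComplexRecordSystem.incl_unif`).
[cite: Milne2005ShimuraVarieties, Lemma 5.13 p. 57] [cite: GenestierNgo2020, Prop. 1.3.2] -/
theorem SiegelModuliDatum.exists_pieceMap (hδ : IsPolarizationType δ) (hg : 0 < g) {N : ℕ} (hN : 3 ≤ N)
    (D : SiegelModuliDatum g δ N) {r : gspFinAdelic δ} (hr : r ∈ principalLevelSubgroup δ 1) :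
    ∃ ι : Literature.AlgebraicGeometry.Motives.ComplexPoints D.S → SiegelShimuraSet δ (principalLevelSubgroup δ N),
      Function.Injective ι ∧
        ∀ Z : siegelUpperHalfSpace g,
          ι (D.unif Z) = SiegelShimuraSet.mk δ (principalLevelSubgroup δ N) ⟨jOfSiegel δ Z, jOfSiegel_coe_mem_C0pm hδ.1 Z⟩ r := by
  classical
  -- a section of `unif` on `S(ℂ)`
  have hsec : ∀ P : Literature.AlgebraicGeometry.Motives.ComplexPoints D.S, ∃ Z : siegelUpperHalfSpace g, D.unif Z = P :=
    fun P => by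
      obtain ⟨Z, hZ, hZP⟩ := D.exists_eq_unif P
      exact ⟨⟨Z, hZ⟩, hZP⟩
  choose σ hσ using hsec
  refine ⟨fun P => SiegelShimuraSet.mk δ (principalLevelSubgroup δ N) ⟨jOfSiegel δ (σ P), jOfSiegel_coe_mem_C0pm hδ.1 (σ P)⟩ r,
    fun P Q hPQ => ?_, fun Z => ?_⟩
  · have h := (SiegelShimuraSet.mk_jOfSiegel_eq_mk_jOfSiegel_iff_unif_eq_unif hδ hg hN D hr (σ P) (σ Q)).1 hPQ
    rw [hσ, hσ] at h
    exact h.symm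
  · exact (SiegelShimuraSet.mk_jOfSiegel_eq_mk_jOfSiegel_iff_unif_eq_unif hδ hg hN D hr (σ (D.unif Z)) Z).2
      ((hσ (D.unif Z)).symm ▸ rfl)

end Pieces

end Literature.AlgebraicGeometry.ModuliOfAbelianVarieties

end
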